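import Summits.QuantumFields.YangMills.Theses.BalabanUVNodes
import Literature.MathematicalPhysics.QuantumFieldTheory.Balaban1983to89.Node00.Record13SepCoPH
import Summits.QuantumFields.BalabanUV.Gaps.EndSurvivorCensus
import Summits.QuantumFields.YangMills.Theorems.BalabanUVNodesK2JsOfRecord
import Summits.QuantumFields.YangMills.Theorems.BalabanUVNodesK2Line1PrimeRemainderPrice
import Mathlib.Analysis.SpecialFunctions.Pow.Asymptotics
import Mathlib.Analysis.SpecialFunctions.Pow.Continuity

/-!
# Idea-2 (g4) sketch — `peel-two-threshold-modulus`, EDITION 2: the peeling modulus RE-KEYED TO IN-WINDOW RUNS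

Crux K2⁷ `stmt-QuantumFields-20543` = `Summit.QuantumFields.YangMills.Theses.BalabanUVNodes.EndpointGivenBR13SepCoPH`.
Seat `ym-nodeO-idea-2` gen 4 (ideator, lens «ideate-on-items — second angle»).  Answers CRIT-1 g4's BN-F addendum
(`Cruxes/EndpointGivenBR13SepCoPH/CRIT-1-BNF-addendum.md` §2 row idea-2): the g2 letters `ModulusBound`∕`ModAtN` were BOX-WIDE ∀k at a fixed level and
pinned the off-run LAST slot (HIT twice by idea-5 g3's barrier note BN-F, `GaugeSlotIRProbe.lean`); REQUIRED RE-KEY = the run-wise modulus letter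
(idea-5 ed. 2.2 `Idea5GaugeSlot.ModOnRuns`∕`ModPkgOnRuns`).  This file does exactly that, with the modulus DISPLAYED so that the peeling supplier names it,
and types the supplier's two inputs run-wise (§4); §3b keys the stub on the crux's FULL PREFIX (director-ym DECISION №204: guard, admissibility, printed (B), window as
INPUTS) and composes that weaker-by-name text to the crux too; §3c relates the modulus letter to DEF-1's tree letter `RunConstRemainder` (p596574).  Crux workfiles are not importable on the farm, so idea-5's two run-keyed SHAPES are re-declared
verbatim here (credited) and composed to the crux through the TREE road `Gaps.EndSurvivorCensus.endpointExistence_datum_of_survivorLetters_runwisePS`.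

HONEST FRAMING: nothing of Bałaban's is asserted or proved here; every `def … : Prop` is a hypothesis SHAPE; the theorems are bookkeeping
(real analysis on letters).  K2⁷ is OPEN; [I] = CMP 109 Thm 2 ∕ (0.31) p. 259 is UNPROVED IN PRINT; route R4 `BalabanUVNodes` closes only the
CONDITIONAL finite-𝕋⁴ rung `BalabanLadder.UV`; the Yang–Mills mass gap (Clay) is NOT proved by any of this.
-/

noncomputable section

open Filter Topology

namespace Summit.QuantumFields.YangMills.Cruxes.EndpointGivenBR13SepCoPH.Idea2g4

open Literature.MathematicalPhysics.QuantumFieldTheory.Balaban1983to89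
open Literature.MathematicalPhysics.QuantumFieldTheory.Balaban1983to89.FlowStep
open Literature.MathematicalPhysics.QuantumFieldTheory.Balaban1983to89.DagBinding (EndpointExistence)
open Literature.MathematicalPhysics.QuantumFieldTheory.Balaban1983to89.T4Continuum (T4Family)
open Literature.MathematicalPhysics.QuantumFieldTheory.Balaban1983to89.Beta.Drift (OneLoopDrift sum_Ico_ge_of_drift)
open Summit.QuantumFields.BalabanUV.Gaps.EndSurvivorCensus (endpointExistence_datum_of_survivorLetters_runwisePS)
open Summit.QuantumFields.YangMills.Theorems.BalabanUVNodesK2JsOfRecord (StepColourData beta0OfJs stepBal_L_pos)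

/-! ## §1 The peeling modulus `K·ε·g^a + V·exp(−c·ε²·(g⁻¹)^{2−2a})` (edition 1 §2, unchanged) -/

/-- **The two-threshold peeling modulus** (letters as in edition 1: `ε` the record's fixed (2.9) threshold, `a ∈ ]0,1[` the peeling exponent —
inner threshold `ε·g_k^a` —, `K` the constant of the threshold-LINEAR remainder law run on the deep region, `V, c` the volume∕gap constants of the Gaussian
weight of the shell `ε g_k^a ≤ |B′| < ε`). A FUNCTION, no claim. [cite: Balaban1987RG1, (2.9) p.266 («Another possibility is to take g_k γ_k ε₁ instead of ε₁»); Balaban1988RG2Cluster, (2.39)–(2.41) p.21] -/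
def peelModulus (K ε a c V : ℝ) (g : ℝ) : ℝ :=
  K * ε * g ^ a + V * Real.exp (-(c * ε ^ 2 * g⁻¹ ^ (2 - 2 * a)))

/-- the peeling modulus tends to `0` at `0⁺` (`0 < a < 1`, `0 < c`, `ε ≠ 0`). [folklore] -/
theorem tendsto_peelModulus {K ε a c V : ℝ} (hε : ε ≠ 0) (ha0 : 0 < a) (ha1 : a < 1) (hc : 0 < c) :
    Tendsto (peelModulus K ε a c V) (𝓝[>] 0) (𝓝 0) := by
  have h1 : Tendsto (fun g : ℝ => K * ε * g ^ a) (𝓝[>] 0) (𝓝 0) := by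
    have h0 : Tendsto (fun g : ℝ => g ^ a) (𝓝[>] 0) (𝓝 0) := by
      have hca : ContinuousAt (fun g : ℝ => g ^ a) 0 := Real.continuousAt_rpow_const 0 a (Or.inr ha0.le)
      have ht := hca.tendsto
      rw [Real.zero_rpow ha0.ne'] at ht
      exact ht.mono_left nhdsWithin_le_nhds
    simpa using h0.const_mul (K * ε)
  have h2 : Tendsto (fun g : ℝ => V * Real.exp (-(c * ε ^ 2 * g⁻¹ ^ (2 - 2 * a)))) (𝓝[>] 0) (𝓝 0) := by
    have hA : Tendsto (fun g : ℝ => g⁻¹ ^ (2 - 2 * a)) (𝓝[>] 0) atTop :=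
      (tendsto_rpow_atTop (by linarith)).comp tendsto_inv_nhdsGT_zero
    have hpos : 0 < c * ε ^ 2 := mul_pos hc (by positivity)
    have hB : Tendsto (fun g : ℝ => c * ε ^ 2 * g⁻¹ ^ (2 - 2 * a)) (𝓝[>] 0) atTop := hA.const_mul_atTop hpos
    have hC : Tendsto (fun g : ℝ => Real.exp (-(c * ε ^ 2 * g⁻¹ ^ (2 - 2 * a)))) (𝓝[>] 0) (𝓝 0) :=
      Real.tendsto_exp_atBot.comp (tendsto_neg_atTop_atBot.comp hB)
    simpa using hC.const_mul V
  show Tendsto (fun g => peelModulus K ε a c V g) _ _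
  simpa [peelModulus] using h1.add h2

/-- from `ω → 0` at `0⁺`: below some `u > 0` the modulus is `< s`. [folklore] -/
theorem exists_lt_of_tendsto {ω : ℝ → ℝ} (hω : Tendsto ω (𝓝[>] 0) (𝓝 0)) {s : ℝ} (hs : 0 < s) :
    ∃ u : ℝ, 0 < u ∧ ∀ g : ℝ, 0 < g → g < u → ω g < s := by
  have hev : ∀ᶠ g in 𝓝[>] (0 : ℝ), ω g ∈ Set.Iio s := hω (isOpen_Iio.mem_nhds hs)
  obtain ⟨u, hu, hsub⟩ := mem_nhdsGT_iff_exists_Ioo_subset.mp hev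
  exact ⟨u, hu, fun g hg hgu => hsub ⟨hg, hgu⟩⟩

/-! ## §2 The run-keyed letters (verbatim the SHAPES of idea-5 ed. 2.2 `Idea5GaugeSlot.ModOnRuns` ∕ `ModPkgOnRuns`, modulus displayed) -/

/-- **`ModOnRuns β b c ω γ₀`** (= idea-5's `Idea5GaugeSlot.ModOnRuns`, crux workfile `GaugeSlotIRProbe.lean` :170, re-declared because crux workfiles are not
importable): along every IN-WINDOW RUN of (0.20) at level `γ₀`, `|β_{j+1}(g_0,…,g_j) − c·b_j| ≤ ω(g_j)` — the last slot of a run prefix IS the true coupling;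
no box-wide ∀k clause, no off-run last slot (BN-F's UV-admissibility test passes). [cite: Balaban1987RG1, Thm 3 p.264 and (2.13) p.268] -/
def ModOnRuns (β : HBeta) (b : ℕ → ℝ) (c : ℝ) (ω : ℝ → ℝ) (γ₀ : ℝ) : Prop :=
  ∀ (n : ℕ) (gs : ℕ → ℝ), RGEqH n β gs → Step.InInterval γ₀ n gs → ∀ j, j < n → |β j (prefixOf gs j) - c * b j| ≤ ω (gs j)

/-- In-window runs restrict to lower levels. [folklore] -/
theorem inInterval_mono {γ γ' : ℝ} {n : ℕ} {gs : ℕ → ℝ} (h : Step.InInterval γ n gs) (hle : γ ≤ γ') :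
    Step.InInterval γ' n gs := fun k hk => ⟨(h k hk).1, (h k hk).2.trans hle⟩

/-- `ModOnRuns` restricts to lower levels. [folklore] -/
theorem modOnRuns_mono {β : HBeta} {b : ℕ → ℝ} {c : ℝ} {ω : ℝ → ℝ} {γ₀ γ₁ : ℝ} (h : ModOnRuns β b c ω γ₀) (hle : γ₁ ≤ γ₀) :
    ModOnRuns β b c ω γ₁ := fun n gs hrg hI j hj => h n gs hrg (inInterval_mono hI hle) j hj

/-- EDITION 2 IS WEAKER THAN EDITION 1 (sanity): a BOX-WIDE modulus letter `∀ k, ∀ p ∈ ]0,γ₀]^{k+1}, |β_k(p) − c b_k| ≤ ω(p_last)` implies the run-keyed one,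
since the prefixes of an in-window run lie in the box. [folklore] -/
theorem modOnRuns_of_box {β : HBeta} {b : ℕ → ℝ} {c : ℝ} {ω : ℝ → ℝ} {γ₀ : ℝ}
    (h : ∀ (k : ℕ) (p : Fin (k + 1) → ℝ), p ∈ B12Beta.HistBox γ₀ k → |β k p - c * b k| ≤ ω (p (Fin.last k))) :
    ModOnRuns β b c ω γ₀ := by
  intro n gs _hrg hI j hj
  have hp : prefixOf gs j ∈ B12Beta.HistBox γ₀ j := fun i =>
    ⟨(hI i (le_trans (Nat.le_of_lt_succ i.isLt) hj.le)).1, (hI i (le_trans (Nat.le_of_lt_succ i.isLt) hj.le)).2⟩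
  simpa using h j (prefixOf gs j) hp

/-- **RUN-WISE (PS) FROM DRIFT + RUN-KEYED MODULUS** (idea-5's `runwisePS_of_drift_modOnRuns`, re-proved here): if the named numbers drift with slope
`slope > 0`, `0 < c`, and `ω → 0` at `0⁺`, then at some level `γ₁ ≤ γ₀` every in-window run has all its β-window-sums `≥ −2·c·A`. [cite: Balaban1987RG1, Thm 2 p.259 (first sentence) and (2.12)–(2.14) p.268] -/
theorem runwisePS_of_drift_modOnRuns {β : HBeta} {b : ℕ → ℝ} {c slope A γ₀ : ℝ} {ω : ℝ → ℝ} (hγ₀ : 0 < γ₀) (hc : 0 < c)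
    (hslope : 0 < slope) (hdrift : OneLoopDrift slope A b) (hω : Tendsto ω (𝓝[>] 0) (𝓝 0)) (hmod : ModOnRuns β b c ω γ₀) :
    ∃ γ₁ : ℝ, 0 < γ₁ ∧ γ₁ ≤ γ₀ ∧ ∀ (n : ℕ) (gs : ℕ → ℝ), RGEqH n β gs → Step.InInterval γ₁ n gs →
      ∀ k, k ≤ n → -(2 * c * A) ≤ ∑ j ∈ Finset.Ico k n, β j (prefixOf gs j) := by
  obtain ⟨u, hu, hωu⟩ := exists_lt_of_tendsto hω (half_pos (mul_pos hc hslope))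
  refine ⟨min γ₀ (u / 2), lt_min hγ₀ (half_pos hu), min_le_left _ _, fun n gs hrg hI k hkn => ?_⟩
  have hmod' := modOnRuns_mono hmod (min_le_left γ₀ (u / 2))
  have hterm : ∀ j ∈ Finset.Ico k n, c * b j - c * slope / 2 ≤ β j (prefixOf gs j) := by
    intro j hj
    have hjn : j < n := (Finset.mem_Ico.mp hj).2
    have hgj := hI j hjn.le
    have hωj : ω (gs j) < c * slope / 2 :=
      hωu (gs j) hgj.1 (lt_of_le_of_lt hgj.2 (lt_of_le_of_lt (min_le_right _ _) (half_lt_self hu)))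
    have := (abs_le.mp (hmod' n gs hrg hI j hjn)).1
    linarith
  have hsum := Finset.sum_le_sum hterm
  have hd := sum_Ico_ge_of_drift hdrift hkn
  have hcard : ∑ j ∈ Finset.Ico k n, (c * b j - c * slope / 2) = c * (∑ j ∈ Finset.Ico k n, b j) - c * slope / 2 * ((n : ℝ) - k) := by
    rw [Finset.sum_sub_distrib, Finset.sum_const, Nat.card_Ico, nsmul_eq_mul, ← Finset.mul_sum, Nat.cast_sub hkn]; ring
  have hnk : (0 : ℝ) ≤ (n : ℝ) - k := by
    have : (k : ℝ) ≤ n := by exact_mod_cast hkn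
    linarith
  have hA := hdrift.nonneg
  nlinarith [hsum, hd, hcard, hnk, hc, hslope, mul_nonneg hc.le hnk]

variable (F : T4Family) (κ : StepColourData) (θ : Node00.Stage13HParams F 2) (hP : θ.Provisos₁₃SepCoPH F 2)

/-- **`ModPkgOnRunsMod F κ θ hP ω` — THE CARD'S CURRENCY, EDITION 2: the run-keyed modulus package at the record with the modulus `ω` DISPLAYED.**
(M) `ModOnRuns` at some level `γ₀ ≤ θ.γ` for the record's β (`(datumOfRecord₁₃SepCoPH F 2 θ hP).βfun`) against the chart-normalised named one-loop numbers
`θ.cβ · beta0OfJs F κ j` (CRIT-1 g2: κ AFTER θ, `θ.cβ` carried); (Cˢ)∕(Uˢ) the Gaps survivor letters at every level `γ₁ ≤ γ₀` — continuity of the one-variable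
trace and a per-scale bound, on the survivor sets of the ONE bare variable.  = idea-5 ed. 2.2 `ModPkgOnRuns` with `∃ ω` pulled out. A PREDICATE, never asserted.
[cite: Balaban1987RG1, Thm 3 p.264, (2.12)–(2.14) p.268 and (5.10) p.293] -/
def ModPkgOnRunsMod (ω : ℝ → ℝ) : Prop :=
  ∃ γ₀ : ℝ, 0 < γ₀ ∧ γ₀ ≤ θ.γ ∧
    ModOnRuns (Node00.datumOfRecord₁₃SepCoPH F 2 θ hP).βfun (beta0OfJs F κ) θ.cβ ω γ₀ ∧
    (∀ γ₁ : ℝ, 0 < γ₁ → γ₁ ≤ γ₀ → ∀ k : ℕ,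
      ContinuousOn (fun x : ℝ => (Node00.datumOfRecord₁₃SepCoPH F 2 θ hP).βfun k
        (clampPrefix (Node00.datumOfRecord₁₃SepCoPH F 2 θ hP).βfun γ₁ k x))
        {x : ℝ | 0 < x ∧ x ≤ γ₁ ∧ ∀ j, j ≤ k → 1 / γ₁ ^ 2 ≤ Y (Node00.datumOfRecord₁₃SepCoPH F 2 θ hP).βfun γ₁ j x}) ∧
    (∀ γ₁ : ℝ, 0 < γ₁ → γ₁ ≤ γ₀ → ∀ k : ℕ, ∃ B : ℝ, ∀ x : ℝ, 0 < x → x ≤ γ₁ →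
      (∀ j, j ≤ k → 1 / γ₁ ^ 2 ≤ Y (Node00.datumOfRecord₁₃SepCoPH F 2 θ hP).βfun γ₁ j x) →
      (Node00.datumOfRecord₁₃SepCoPH F 2 θ hP).βfun k (clampPrefix (Node00.datumOfRecord₁₃SepCoPH F 2 θ hP).βfun γ₁ k x) ≤ B)

/-- idea-5 ed. 2.2's package (modulus hidden): SOME `ω → 0` at `0⁺`. [folklore] -/
def ModPkgOnRuns : Prop :=
  ∃ ω : ℝ → ℝ, Tendsto ω (𝓝[>] 0) (𝓝 0) ∧ ModPkgOnRunsMod F κ θ hP ω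

variable {F κ θ hP}

/-- **END OF THE RECORD DATUM FROM (D1)-DRIFT + THE RUN-KEYED MODULUS PACKAGE** through the TREE road
`Gaps.EndSurvivorCensus.endpointExistence_datum_of_survivorLetters_runwisePS` BY NAME (kernel, no sorry). [cite: Balaban1987RG1, Thm 2 p.259 (first sentence) and (0.20) p.256] -/
theorem endpoint_of_drift_modPkgOnRunsMod (hθ : θ.Admissible F 2) {A : ℝ} {ω : ℝ → ℝ}
    (hdrift : OneLoopDrift (B12Normalization.stepBal 2 (F.L : ℝ)) A (beta0OfJs F κ)) (hω : Tendsto ω (𝓝[>] 0) (𝓝 0))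
    (hpkg : ModPkgOnRunsMod F κ θ hP ω) :
    EndpointExistence (Node00.datumOfRecord₁₃SepCoPH F 2 θ hP).C.toB12 := by
  obtain ⟨γ₀, hγ₀, _hγθ, hmod, hsc, hsl⟩ := hpkg
  have hc : 0 < θ.cβ := hθ.toStage12.toStage9.chart.1
  obtain ⟨γ₁, hγ₁, hγ₁₀, hrun⟩ :=
    runwisePS_of_drift_modOnRuns hγ₀ hc (stepBal_L_pos (F := F) two_pos) hdrift hω hmod
  have hM : 0 ≤ 2 * θ.cβ * A := by have := hdrift.nonneg; positivity
  exact endpointExistence_datum_of_survivorLetters_runwisePS (Node00.datumOfRecord₁₃SepCoPH F 2 θ hP) hγ₁ hM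
    (hsc γ₁ hγ₁ hγ₁₀) (hsl γ₁ hγ₁ hγ₁₀) hrun

/-! ## §3 The stubs, edition 2 (run-keyed), and the composition to the crux BY NAME -/

/-- **STUB 2ᴾᴿ «PEELING MODULUS ON RUNS AT NAMED JETS» `PeelOnRunsEachJets13`** (this card's load-bearing hypothesis, edition 2): at every proviso-carrying
admissible Stage-13 tuple SOME colour datum `κ` (after `θ`) and peeling letters `K ε a c V` (`ε ≠ 0`, `0 < a < 1`, `0 < c`; intended `ε = θ.ε₂₉`) give the
run-keyed modulus package with `ω = peelModulus K ε a c V`: along every in-window run of the record's (0.20),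
`|β_{j+1}(g_0,…,g_j) − θ.cβ·β⁰_j(κ)| ≤ K·ε·g_j^a + V·exp(−c·ε²·g_j^{2a−2})`.  NOT PRINTED (the device — a coupling-scaled inner threshold — is only announced
at [I] p.266 and [II] p.8); a hypothesis SHAPE, never a fact. [cite: Balaban1987RG1, (2.9) p.266; Balaban1988RG2Cluster, (1.29) p.8 and (2.39)–(2.41) p.21] -/
def PeelOnRunsEachJets13 : Prop :=
  ∀ (F : T4Family) (θ : Node00.Stage13HParams F 2) (hP : θ.Provisos₁₃SepCoPH F 2), θ.Admissible F 2 →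
    ∃ (κ : StepColourData) (K ε a c V : ℝ), ε ≠ 0 ∧ 0 < a ∧ a < 1 ∧ 0 < c ∧ ModPkgOnRunsMod F κ θ hP (peelModulus K ε a c V)

/-- the mechanism-agnostic run-keyed modulus stub 2ᴹᴿ (= idea-5 ed. 2.2 `ModulusOnRunsAtJets13`, SHARED by name of shape): SOME vanishing modulus. [folklore] -/
def ModulusOnRunsAtJets13 : Prop :=
  ∀ (F : T4Family) (θ : Node00.Stage13HParams F 2) (hP : θ.Provisos₁₃SepCoPH F 2), θ.Admissible F 2 → ∃ κ : StepColourData, ModPkgOnRuns F κ θ hP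

/-- peeling on runs ⟹ modulus on runs (kernel). [folklore] -/
theorem modulusOnRuns_of_peel (h : PeelOnRunsEachJets13) : ModulusOnRunsAtJets13 := by
  intro F θ hP hθ
  obtain ⟨κ, K, ε, a, c, V, hε, ha0, ha1, hc, hM⟩ := h F θ hP hθ
  exact ⟨κ, peelModulus K ε a c V, tendsto_peelModulus hε ha0 ha1 hc, hM⟩

/-- **STUB 1ᴹᴿ = row (D1) keyed on the run package** (= idea-5 ed. 2.2 `D1AtModRunsJets13` verbatim in shape; SHARED, not this card's business): the NAMED
numbers of a colour datum that shadows the record run-wise drift with the bare slope `stepBal 2 F.L`. A hypothesis SHAPE. [cite: Balaban1987RG1, (1.3) p.260 and (2.12)–(2.13) p.268] -/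
def D1AtModRunsJets13 : Prop :=
  ∀ (F : T4Family) (κ : StepColourData) (θ : Node00.Stage13HParams F 2) (hP : θ.Provisos₁₃SepCoPH F 2), θ.Admissible F 2 →
    ModPkgOnRuns F κ θ hP → ∃ A : ℝ, OneLoopDrift (B12Normalization.stepBal 2 (F.L : ℝ)) A (beta0OfJs F κ)

/-- **THE COMPOSITION, EDITION 2 (kernel, no sorry): `D1AtModRunsJets13 → ModulusOnRunsAtJets13 → K2⁷` BY NAME**; `(B)`, unity∕slots and the window
hypothesis are carried unused, exactly as in every registered line. -/
theorem EndpointGivenBR13SepCoPH_of_modRuns (h₁ : D1AtModRunsJets13) (h₂ : ModulusOnRunsAtJets13) :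
    Summit.QuantumFields.YangMills.Theses.BalabanUVNodes.EndpointGivenBR13SepCoPH := by
  intro F θ hP _hU hθ _hB _hwin
  obtain ⟨κ, hpkg⟩ := h₂ F θ hP hθ
  obtain ⟨A, hdrift⟩ := h₁ F κ θ hP hθ hpkg
  obtain ⟨ω, hω, hpkgω⟩ := hpkg
  exact endpoint_of_drift_modPkgOnRunsMod hθ hdrift hω hpkgω

/-- **… and from the PEELING stub itself: `D1AtModRunsJets13 → PeelOnRunsEachJets13 → K2⁷`** (kernel, no sorry). -/
theorem EndpointGivenBR13SepCoPH_of_peelRuns (h₁ : D1AtModRunsJets13) (h₂ : PeelOnRunsEachJets13) :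
    Summit.QuantumFields.YangMills.Theses.BalabanUVNodes.EndpointGivenBR13SepCoPH :=
  EndpointGivenBR13SepCoPH_of_modRuns h₁ (modulusOnRuns_of_peel h₂)

/-! ## §3b DECISION №204 conformity (director-ym LINE №204; CRIT-1 g4 02:20Z pre-registration note): the stub keyed on the crux's FULL PREFIX

Plan g82's draft skeleton v5 keys every stub on the crux's full prefix — the unity∕slots guard, `Admissible`, the printed (B) `B16.EndStatementBPrinted …` and the
window hypothesis — so that NO text speaks about parameter tuples at which (B) fails (DEF-1 g3 decl note A0: beyond `sup dist₁` the (2.9) cut-off is ≡ 1 and an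
un-keyed ∀θ (D4)-text would speak about the UN-CUT β).  The GIVEN-(B) edition of 2ᴾᴿ below is WEAKER BY NAME than `PeelOnRunsEachJets13` and still composes to K2⁷. -/

/-- **STUB 2ᴾᴿᴮ `PeelOnRunsEachJets13GivenB`** — 2ᴾᴿ keyed on the crux's FULL prefix (unity∕slots guard, admissibility, printed (B), window hypothesis — all VERBATIM
from the crux signature, as INPUTS).  The registered text a crux-plan should cut.  A hypothesis SHAPE, never a fact. [cite: Balaban1987RG1, (2.9) p.266 and Thm 3 p.264; Balaban1988RG2Cluster, (2.39)–(2.41) p.21] -/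
def PeelOnRunsEachJets13GivenB : Prop :=
  ∀ (F : T4Family) (θ : Node00.Stage13HParams F 2) (hP : θ.Provisos₁₃SepCoPH F 2),
    (θ.ZhUnity F 2 ∧ θ.SlotsNondegenerate₁₃ F 2) → θ.Admissible F 2 →
    B16.EndStatementBPrinted (Node00.datumOfRecord₁₃SepCoPH F 2 θ hP).C →
    (∃ γ₁ : ℝ, 0 < γ₁ ∧ ∀ γ : ℝ, 0 < γ → γ ≤ γ₁ → ∃ P : B12.RunParams, 1 ≤ P.K ∧
      ((Node00.datumOfRecord₁₃SepCoPH F 2 θ hP).C P).flow.InInterval γ P.K) →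
    ∃ (κ : StepColourData) (K ε a c V : ℝ), ε ≠ 0 ∧ 0 < a ∧ a < 1 ∧ 0 < c ∧ ModPkgOnRunsMod F κ θ hP (peelModulus K ε a c V)

/-- the un-keyed text implies the GIVEN-(B) text (weaker by name: three extra inputs left unread). [folklore] -/
theorem peelOnRunsGivenB_of_peelOnRuns (h : PeelOnRunsEachJets13) : PeelOnRunsEachJets13GivenB :=
  fun F θ hP _ hθ _ _ => h F θ hP hθ

/-- **THE COMPOSITION UNDER DECISION №204 (kernel, no sorry): `D1AtModRunsJets13 → PeelOnRunsEachJets13GivenB → K2⁷` BY NAME** — the guard `hU`, (B) `hB` and the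
window `hwin` are now CONSUMED by the stub instead of discarded. [cite: Balaban1987RG1, Thm 2 p.259 (first sentence) and (0.20) p.256] -/
theorem EndpointGivenBR13SepCoPH_of_peelRunsGivenB (h₁ : D1AtModRunsJets13) (h₂ : PeelOnRunsEachJets13GivenB) :
    Summit.QuantumFields.YangMills.Theses.BalabanUVNodes.EndpointGivenBR13SepCoPH := by
  intro F θ hP hU hθ hB hwin
  obtain ⟨κ, K, ε, a, c, V, hε, ha0, ha1, hc, hM⟩ := h₂ F θ hP hU hθ hB hwin
  have hpkg : ModPkgOnRuns F κ θ hP := ⟨peelModulus K ε a c V, tendsto_peelModulus hε ha0 ha1 hc, hM⟩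
  obtain ⟨A, hdrift⟩ := h₁ F κ θ hP hθ hpkg
  exact endpoint_of_drift_modPkgOnRunsMod hθ hdrift (tendsto_peelModulus hε ha0 ha1 hc) hM

/-! ## §3c Relation to DEF-1's TREE letter `RunConstRemainder` (p596574 `BalabanUVNodesK2NamedJetsRunRemAt` :92): below some level the run-keyed MODULUS letter gives the
run-keyed CONSTANT letter with ANY prescribed positive constant — the modulus edition is the constant edition «with the seam dissolved» (no `s ≤ c·stepBal` bet between
unrelated constants: shrink the level until `ω ≤ s`).  Index conventions: `ModOnRuns` bounds the prefixes `j < n` of a run of length `n`; DEF-1's letter bounds `k ≤ n`;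
a run of length `n+1` covers `k = n`, so the comparison is stated for prefixes that EXTEND in the window (the only ones END reads). -/

/-- modulus on runs + `ω → 0` ⟹ for every `s > 0`, at some level `γ₁ ≤ γ₀`, `|β_j(prefix) − c b_j| ≤ s` along in-window runs (`j < n`). [folklore] -/
theorem runConst_of_modOnRuns {β : HBeta} {b : ℕ → ℝ} {c γ₀ : ℝ} {ω : ℝ → ℝ} (hγ₀ : 0 < γ₀)
    (hω : Tendsto ω (𝓝[>] 0) (𝓝 0)) (hmod : ModOnRuns β b c ω γ₀) {s : ℝ} (hs : 0 < s) :
    ∃ γ₁ : ℝ, 0 < γ₁ ∧ γ₁ ≤ γ₀ ∧ ∀ (n : ℕ) (gs : ℕ → ℝ), RGEqH n β gs → Step.InInterval γ₁ n gs →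
      ∀ j, j < n → |β j (prefixOf gs j) - c * b j| ≤ s := by
  obtain ⟨u, hu, hωu⟩ := exists_lt_of_tendsto hω hs
  refine ⟨min γ₀ (u / 2), lt_min hγ₀ (half_pos hu), min_le_left _ _, fun n gs hrg hI j hj => ?_⟩
  have hmod' := modOnRuns_mono hmod (min_le_left γ₀ (u / 2))
  have hb := hmod' n gs hrg hI j hj
  have hgj := hI j (le_of_lt hj)
  have hωj : ω (gs j) < s := hωu (gs j) hgj.1 (by linarith [hgj.2, min_le_right γ₀ (u / 2)])
  linarith

/-! ## §4 The supplier's two inputs, RUN-KEYED (what a crux-plan would cut as the peel line's internal stubs)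

The peel at scale `j` splits the record's fixed small-field window `|B′| < ε` of the `j`-th fluctuation integral at the INNER, coupling-scaled threshold
`ε·g_j^a`: DEEP part (threshold-linear remainder law, constant `K`, run on `|B′| < ε g_j^a`) + SHELL `ε g_j^a ≤ |B′| < ε` (Gaussian weight).  At the level
of NUMBERS this is a triangle inequality through an auxiliary «deep» β-family `βd` (the record's β-functional with the inner threshold at the current step —
to be DEFINED by the plan from the record's machinery, e.g. idea-1's threshold-parametrised `betaAt`; NOT defined here), evaluated along the RECORD's runs. -/

/-- (P1ᴿ) **deep remainder law on runs**: along in-window runs of `β` at level `γ₀`, the deep family is within `K·ε·g_j^a` of `c·b_j`. A SHAPE. [cite: Balaban1988RG2Cluster, (2.39)–(2.41) p.21 («O(1)C₃ε₁», with ε₁ ↦ ε g^a)] -/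
def DeepRemOnRuns (β βd : HBeta) (b : ℕ → ℝ) (c K ε a γ₀ : ℝ) : Prop :=
  ∀ (n : ℕ) (gs : ℕ → ℝ), RGEqH n β gs → Step.InInterval γ₀ n gs → ∀ j, j < n → |βd j (prefixOf gs j) - c * b j| ≤ K * ε * gs j ^ a

/-- (P2ᴿ) **shell law on runs**: along in-window runs of `β` at level `γ₀`, record minus deep is bounded by the Gaussian shell weight. A SHAPE. [cite: Balaban1987RG1, (2.9)–(2.11) p.266 (Gaussian small-field weights)] -/
def ShellOnRuns (β βd : HBeta) (c ε a V γ₀ : ℝ) : Prop :=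
  ∀ (n : ℕ) (gs : ℕ → ℝ), RGEqH n β gs → Step.InInterval γ₀ n gs → ∀ j, j < n →
    |β j (prefixOf gs j) - βd j (prefixOf gs j)| ≤ V * Real.exp (-(c * ε ^ 2 * (gs j)⁻¹ ^ (2 - 2 * a)))

/-- **(P1ᴿ) + (P2ᴿ) ⟹ the run-keyed peeling modulus letter** (kernel, triangle inequality). [folklore] -/
theorem modOnRuns_of_peel {β βd : HBeta} {b : ℕ → ℝ} {c K ε a cg V γ₀ : ℝ}
    (hdeep : DeepRemOnRuns β βd b c K ε a γ₀) (hshell : ShellOnRuns β βd cg ε a V γ₀) :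
    ModOnRuns β b c (peelModulus K ε a cg V) γ₀ := by
  intro n gs hrg hI j hj
  have h1 := hdeep n gs hrg hI j hj
  have h2 := hshell n gs hrg hI j hj
  have htri : |β j (prefixOf gs j) - c * b j| ≤
      |β j (prefixOf gs j) - βd j (prefixOf gs j)| + |βd j (prefixOf gs j) - c * b j| := by
    have := abs_sub_le (β j (prefixOf gs j)) (βd j (prefixOf gs j)) (c * b j)
    exact this
  unfold peelModulus
  linarith

end Summit.QuantumFields.YangMills.Cruxes.EndpointGivenBR13SepCoPH.Idea2g4

end
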